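import Summits.CriticalPhenomena.PercolationContinuityZ3.Theorems.PercNearOneGluingNoHeavyQuantTargetPropertyThinAt
import Literature.Probability.Percolation.KozmaNitzanSteps
import HarnessLib

/-!
# QUANT lane (R2, step S4a): the failure bound (33) of Kozma–Nitzan's exploration from the target property for
# TRANSVERSALLY BOUNDED subboxes

builds on p205010 (kernel theorem, internal audit signed; external expert review pending)

Cell `prim-quant` (post-continuity programme, LANE 1), seat `prim-quant-p2` (METHOD = effective Kozma–Nitzan
reduction), memo `run/shared/lean/prim/quant/P2-EFFECTIVE-KN.md` §2 (T6-eff).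

The tree's `KSch.fail_bound` (`…/KozmaNitzanSteps.lean`; KN (33): after a valid history each examination fails with
probability `≤ ε`) consumes the target lemma as a hypothesis `htgt` of the shape `TargetPropertyAt` (all subboxes `D`,
routes of unbounded scale), which can only be produced from hittability at EVERY scale — vacuous at `p_c`.  It applies
`htgt` only to `D = E_{v,x} ∖ E^j_{v,x}` (`KSch.Dpast`), a box of transversal half-width `5r`.  This file re-runs the
chain `cond_of_face → bad_subset_Bev → real_bad_le → fail_bound` verbatim with `htgt` weakened to
`TargetPropertyThinAt … (5r)` (file `…QuantTargetPropertyThinAt.lean`), discharging the thinness of `Dpast`: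

* `Quant.cond_of_face_thin`, `Quant.bad_subset_Bev_thin`, `Quant.real_bad_le_thin`, `Quant.fail_bound_thin`.

No definitions; no sorries; standard axioms.  [cite: KozmaNitzan2024, §4 pp. 28–31 ((33), Steps I–IV)]
-/

noncomputable section

open MeasureTheory ProbabilityTheory
open scoped ENNReal Classical

namespace Summit.CriticalPhenomena.PercolationContinuityZ3.Theorems.Quant

open Literature.Probability.LatticeModels Literature.Probability.Percolation
open Literature.Probability.Percolation.KozmaNitzan Literature.Probability.Percolation.KozmaNitzan.KSch
open Literature.Probability.Percolation.GadgetSystem Literature.Probability.Percolation.Contour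
open Literature.Probability.Percolation.KozmaNitzan.Cells
open SimpleGraph

variable {d : ℕ} {S : KSch d}

section Setting

variable {h : ProbeHistory (Site d)} {e : Site 2 × MDir} (hV : S.Valid h e) {du : MDir}
  (hdu : du ∈ S.onward h (tgt e))
include hV hdu

/-- **Step III with the THIN target property** (tree `KSch.cond_of_face`, same proof): the subbox
`E_{v,x} ∖ E^j_{v,x}` has transversal half-width `5r`, so the target property for transversally bounded
subboxes (`TargetPropertyThinAt … (5r)`) suffices. [cite: KozmaNitzan2024, §4 p. 30 (Step III)] -/
theorem cond_of_face_thin {δ₂ : ℝ} {R : ℕ}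
    (htgt : TargetPropertyThinAt d S.p S.δc δ₂ (elongList d (2 * S.C.K) (by have := S.C.hK; omega)) R (5 * S.C.r))
    (hRs : 2 * R ≤ S.C.s) {j : ℕ} (hj : j < S.C.K) (o : Finset (Sym2 (Site d)))
    (hface : 1 - δ₂ < (prodBernoulli (S.Wt h e du j o)).real
      (⋃ b ∈ S.C.Face (tgt e) du (j + 1), openConn (0 : Site d) b)) :
    S.cond h e du j o := by
  set D := Dpast S e du j with hD
  have hK : (20 : ℤ) ≤ S.C.K := by exact_mod_cast S.C.hK
  have hs1 : (1 : ℤ) ≤ S.C.s := by exact_mod_cast S.C.hs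
  have hr1 : (1 : ℤ) ≤ S.C.r := by exact_mod_cast S.C.r_pos
  have hrK : (S.C.r : ℤ) = S.C.K * S.C.s := by unfold Cells.r; push_cast; ring
  have hRs' : 2 * (R : ℤ) ≤ S.C.s := by exact_mod_cast hRs
  have hjK : (j : ℤ) + 1 ≤ S.C.K := by exact_mod_cast hj
  have hjs : 10 * (S.C.s : ℤ) * (j + 1) ≤ 10 * S.C.s * S.C.K := mul_le_mul_of_nonneg_left hjK (by positivity)
  have hKs20 : 20 * (S.C.s : ℤ) ≤ S.C.K * S.C.s := mul_le_mul_of_nonneg_right hK (by linarith)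
  have hj0 : (0 : ℤ) ≤ 10 * S.C.s * j := by positivity
  have hDE : D ⊆ S.C.Efar (tgt e) du := Dpast_subset_Efar j
  have hDS : D ⊆ S.Sx h e du := hDE.trans Finset.subset_union_right
  -- the subbox
  have hsub : IsSubbox (S.Wt h e du j o) S.p D := by
    refine ((isSubbox_lattW S.p D).pinW _ fun x hx y hy hyD => ?_).restrW (Finset.coe_subset.2 hDS)
    have hx' : x ∈ S.Fj h e du j := hx
    rw [Fj, mem_edgesIn_iff] at hx'
    rcases Finset.mem_union.1 (hx'.2 y hy) with hy' | hy'
    · rcases Finset.mem_union.1 hy' with hy'' | hy''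
      · exact (Valid.sep_Efar hV hdu).not_mem (Finset.mem_coe.2 hy'') (Finset.mem_coe.2 (hDE hyD))
      · exact Valid.Ewv_not_mem_Efar hV hdu hy'' (hDE hyD)
    · rw [Cells.Stub, mem_sBox_iff (sgOf_sign du)] at hy'
      rw [hD, Dpast, mem_sBox_iff (sgOf_sign du)] at hyD
      linarith [hy'.1.2, hyD.1.1]
  have h0S : (0 : Site d) ∈ S.Sx h e du := Finset.mem_union_left _ (Finset.mem_union_left _ hV.zero_mem)
  have h0D : (0 : Site d) ∉ D := fun h0 =>
    (Valid.sep_Efar hV hdu).not_mem (Finset.mem_coe.2 hV.zero_mem) (Finset.mem_coe.2 (hDE h0))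
  -- the enlarged face lies in `D`
  have hencl : Finset.Icc (sLo (S.C.axOf du) (sgOf du) (S.C.cen (tgt e)) (5 * S.C.r + 10 * S.C.s * (j + 1 : ℕ))
        (5 * S.C.r + 10 * S.C.s * (j + 1 : ℕ)) (2 * S.C.r) - (R : Site d))
      (sHi (S.C.axOf du) (sgOf du) (S.C.cen (tgt e)) (5 * S.C.r + 10 * S.C.s * (j + 1 : ℕ))
        (5 * S.C.r + 10 * S.C.s * (j + 1 : ℕ)) (2 * S.C.r) + (R : Site d)) ⊆ D := by
    rw [sBox_enlarge _ _ (sgOf_sign du)]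
    refine sBox_mono (sgOf_sign du) _ ?_ ?_ ?_
    · push_cast; linarith
    · push_cast; nlinarith
    · linarith
  -- `M_x ⊆ D`
  have hMD : S.C.M (tgt e + stepVec du) ⊆ D := by
    intro y hy
    obtain ⟨hl, ht⟩ := S.C.level_of_mem_M_tgt hy
    rw [hD, Dpast, mem_sBox_iff (sgOf_sign du)]
    refine ⟨⟨by nlinarith [hl.1], by linarith [hl.2]⟩, fun i hi => ?_⟩
    have := ht i hi; constructor <;> linarith [this.1, this.2]
  have hMne : (S.C.M (tgt e + stepVec du)).Nonempty := ⟨_, center_mem_cIcc _ _⟩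
  have hthin : ∃ (a : Fin d) (c : Site d), ∀ y ∈ D, ∀ i : Fin d, i ≠ a →
      c i - ((5 * S.C.r : ℕ) : ℤ) ≤ y i ∧ y i ≤ c i + ((5 * S.C.r : ℕ) : ℤ) := by
    refine ⟨S.C.axOf du, S.C.cen (tgt e), fun y hy i hi => ?_⟩
    rw [hD, Dpast, mem_sBox_iff (sgOf_sign du)] at hy
    have := hy.2 i hi
    push_cast
    exact ⟨this.1, this.2⟩
  exact htgt (S.Wt h e du j o) (S.Sx h e du) D _ _ (S.C.M (tgt e + stepVec du)) 0 (finSupp_restrW _ _) hsub hDS h0S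
    h0D hthin hencl (isTarget_stepIII hRs hj) hMD hMne hface


/-- **Step III inside Step IV**: a bad direction lies in every `B_j` (thin target property). [cite: KozmaNitzan2024, §4 p. 30 (Step III)] -/
theorem bad_subset_Bev_thin {δ₂ : ℝ} {R : ℕ}
    (htgt : TargetPropertyThinAt d S.p S.δc δ₂ (elongList d (2 * S.C.K) (by have := S.C.hK; omega)) R (5 * S.C.r))
    (hRs : 2 * R ≤ S.C.s) {j : ℕ} (hj : j < S.C.K) : S.bad h e du ⊆ S.Bev h e du j δ₂ := by
  intro ω hω
  by_contra hB
  simp only [Bev, Set.mem_setOf_eq, not_le] at hB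
  exact hω j hj (cond_of_face_thin hV hdu htgt hRs hj _ hB)

/-- **(36)–(37) for one direction**: `μ(bad) ≤ (1 - δ₂)^K + ε'`, given Lemma 12 (`hcorr`, at `ε'`)
and the THIN target lemma (`htgt`). [cite: KozmaNitzan2024, §4 p. 31 ((36), (37))] -/
theorem real_bad_le_thin {ε' δ₂ : ℝ} (hδ₂ : δ₂ ≤ 1) {R : ℕ}
    (hcorr : ∀ T : CData d, T.Hyp S.p → T.r = S.C.r →
      1 - S.δc < (prodBernoulli T.W).real
          (⋃ b ∈ Finset.Icc (T.c - ((3 * T.r : ℕ) : Site d)) (T.c + ((3 * T.r : ℕ) : Site d)),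
            openConnIn (↑T.Aset : Set (Site d)) T.o b) →
        1 - ε' < (prodBernoulli T.W).real (⋃ b ∈ T.Tn (3 * T.r), openConnIn (↑T.Uset : Set (Site d)) T.o b))
    (htgt : TargetPropertyThinAt d S.p S.δc δ₂ (elongList d (2 * S.C.K) (by have := S.C.hK; omega)) R (5 * S.C.r))
    (hRs : 2 * R ≤ S.C.s) :
    (prodBernoulli (S.Wfull h e du)).real (S.bad h e du) ≤ (1 - δ₂) ^ S.C.K + ε' := by
  set μ := prodBernoulli (S.Wfull h e du) with hμ
  set Cyl := localCylinder (↑(S.F h) : Set (Sym2 (Site d))) (↑(S.ξ h) : Set (Sym2 (Site d))) with hCyl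
  set L := lattOnly (S.V h ∪ S.C.Ewv e.1 e.2 ∪ S.C.Hfull (tgt e) du) with hL
  have hreach : 1 - ε' < μ.real (S.Reach h e du) := reach_bound hV hdu hcorr
  have hRm : MeasurableSet (S.Reach h e du) := measurableSet_biUnion_openConnIn _ _ _
  have hae : ∀ᵐ ω ∂μ, ω ∈ Cyl ∩ L := by
    filter_upwards [Valid.ae_cyl hV (du := du),
      Valid.ae_lattOnly hV (du := du) (S.V h ∪ S.C.Ewv e.1 e.2 ∪ S.C.Hfull (tgt e) du)] with ω h1 h2
    exact ⟨h1, h2⟩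
  have hnull : μ.real (Cyl ∩ L)ᶜ = 0 := by
    have : μ (Cyl ∩ L)ᶜ = 0 := mem_ae_iff.1 hae
    exact (measureReal_eq_zero_iff (measure_ne_top _ _)).2 this
  have h1 : μ.real (S.bad h e du) ≤ μ.real (S.bad h e du ∩ (Cyl ∩ L)) + μ.real (Cyl ∩ L)ᶜ := by
    refine le_trans (measureReal_mono ?_ (measure_ne_top _ _)) (measureReal_union_le _ _)
    intro ω hω
    by_cases h' : ω ∈ Cyl ∩ L
    · exact Or.inl ⟨hω, h'⟩
    · exact Or.inr h'
  have h2 : S.bad h e du ∩ (Cyl ∩ L) ⊆ (S.Gev h e du δ₂ S.C.K ∩ Cyl) ∪ (S.Reach h e du)ᶜ := by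
    rintro ω ⟨hω, hC, hωL⟩
    by_cases hR : ω ∈ S.Reach h e du
    · refine Or.inl ⟨mem_Gev_of_forall (fun j hj => bad_subset_Bev_thin hV hdu htgt hRs hj hω)
        (fun j hj => mem_Aface_of_reach hV hdu hωL hR hj) _ le_rfl, hC⟩
    · exact Or.inr hR
  have h3 : μ.real (S.Reach h e du)ᶜ < ε' := by
    rw [probReal_compl_eq_one_sub hRm]; linarith
  calc μ.real (S.bad h e du) ≤ μ.real (S.bad h e du ∩ (Cyl ∩ L)) + μ.real (Cyl ∩ L)ᶜ := h1
    _ ≤ μ.real ((S.Gev h e du δ₂ S.C.K ∩ Cyl) ∪ (S.Reach h e du)ᶜ) + 0 := by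
        rw [hnull]; exact add_le_add (measureReal_mono h2 (measure_ne_top _ _)) le_rfl
    _ ≤ μ.real (S.Gev h e du δ₂ S.C.K ∩ Cyl) + μ.real (S.Reach h e du)ᶜ := by
        rw [add_zero]; exact measureReal_union_le _ _
    _ ≤ (1 - δ₂) ^ S.C.K + ε' := add_le_add (real_Gev_le hV hdu hδ₂ _ le_rfl) h3.le

omit hdu in
/-- **(33): the examination fails with probability at most `ε`** — after a valid history, given
Lemma 12 at `ε/8` (`hcorr`), the THIN target lemma with `δ_{L10} = δ₂ ≤ 1` and its `R ≤ s/2` (`htgt`), and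
`(1 - δ₂)^K + ε/8 ≤ ε/4`. [cite: KozmaNitzan2024, §4 pp. 28–31 ((33), Steps I–IV)] -/
theorem fail_bound_thin {ε δ₂ : ℝ} (hε : 0 ≤ ε) (hδ₂ : δ₂ ≤ 1) {R : ℕ}
    (hcorr : ∀ T : CData d, T.Hyp S.p → T.r = S.C.r →
      1 - S.δc < (prodBernoulli T.W).real
          (⋃ b ∈ Finset.Icc (T.c - ((3 * T.r : ℕ) : Site d)) (T.c + ((3 * T.r : ℕ) : Site d)),
            openConnIn (↑T.Aset : Set (Site d)) T.o b) →
        1 - ε / 8 < (prodBernoulli T.W).real (⋃ b ∈ T.Tn (3 * T.r), openConnIn (↑T.Uset : Set (Site d)) T.o b))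
    (htgt : TargetPropertyThinAt d S.p S.δc δ₂ (elongList d (2 * S.C.K) (by have := S.C.hK; omega)) R (5 * S.C.r))
    (hRs : 2 * R ≤ S.C.s) (hKε : (1 - δ₂) ^ S.C.K + ε / 8 ≤ ε / 4) :
    (bondPercolation (zdGraph d) S.p).real {ω | ¬S.succ h e ((S.probe h e).read ω)} ≤ ε := by
  have hcard : ((S.onward h (tgt e)).card : ℝ) ≤ 4 := by
    have h1 : (S.onward h (tgt e)).card ≤ Fintype.card MDir := Finset.card_le_univ _
    have h2 : Fintype.card MDir = 4 := by simp [MDir, Fintype.card_prod, Fintype.card_bool, Fintype.card_fin]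
    have h3 : (S.onward h (tgt e)).card ≤ 4 := h2 ▸ h1
    exact_mod_cast h3
  calc (bondPercolation (zdGraph d) S.p).real {ω | ¬S.succ h e ((S.probe h e).read ω)}
      ≤ (bondPercolation (zdGraph d) S.p).real (⋃ du ∈ S.onward h (tgt e), S.bad h e du) :=
        measureReal_mono (not_succ_subset S h e) (measure_ne_top _ _)
    _ ≤ ∑ du ∈ S.onward h (tgt e), (bondPercolation (zdGraph d) S.p).real (S.bad h e du) :=
        measureReal_biUnion_finset_le _ _
    _ ≤ ∑ du ∈ S.onward h (tgt e), ε / 4 := by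
        refine Finset.sum_le_sum fun du hdu' => ?_
        rw [real_bad_eq]
        exact (real_bad_le_thin hV hdu' hδ₂ hcorr htgt hRs).trans hKε
    _ = (S.onward h (tgt e)).card * (ε / 4) := by rw [Finset.sum_const, nsmul_eq_mul]
    _ ≤ 4 * (ε / 4) := mul_le_mul_of_nonneg_right hcard (by linarith)
    _ = ε := by ring

end Setting

end Summit.CriticalPhenomena.PercolationContinuityZ3.Theorems.Quant

end
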